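import Literature.NumberTheory.Transcendental.UnivExtJetWronskians
import Literature.NumberTheory.Transcendental.PkappaThetaChartIdentities
import Literature.NumberTheory.Transcendental.ThetaAnalytic
import Literature.NumberTheory.Transcendental.PkappaThetaHilbert
import Mathlib.Analysis.Calculus.FDeriv.Analytic
import HarnessLib

/-!
# The Wronskians of the theta model of `M_κ` are quadratic forms (field `wronsk`)

Topic: `Literature/NumberTheory/Transcendental`. A brick for the theta-model instance of the
abstract zero estimate (`ZeroEstModel.lean`, fields `wronsk`, `isHomogeneous_wronsk`, `F_wronsk` of
`AnalyticGroupModel`): for every direction `x ∈ Lie M_κ,ℂ` and all theta indices `I, J`,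

`Θ_J ∂_xΘ_I - Θ_I ∂_xΘ_J = Q_{x,I,J}(Θ)`

with an EXPLICIT quadratic form `Q_{x,I,J}` (the strong form of D. Roy's Lemma 3.1 "derivatives
of regular functions are regular"). Along a torus coordinate `y'_j` and along a fibre coordinate
`s_e` this is immediate (`T_a` is a character; `∂_{s_e}Θ_{(a,(M,e'))} = [e'=e] Θ_{(a,(M,∅))}`).
Along an `E`-coordinate `z'_b` only block `b` moves: with the uniform decomposition
`Θ^P_{(M[b↦l], o)} = P_l(z'_b) Λ - κ_o Z_l(z'_b) a` (`thetaP_update_eq`; `a, Λ` do not depend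
on `z'_b` nor on `l`; `κ_none = 0`, `κ_{some e} = κ_{eb}`), the Wronskian of two theta functions
with block data `(Λ, a, κ)`, `(Λ′, b, κ′)` is

`ΛΛ′(P_jP_i′ - P_iP_j′) - κaΛ′(P_jZ_i′ - P_j′Z_i) + κ′bΛ(P_iZ_j′ - P_i′Z_j) + κκ′ab(Z_jZ_i′ - Z_iZ_j′)`,

and the block identities of `UnivExtJetWronskians.lean` turn this into the value of the quadratic
form with the tables `ω` (`PeriodPair.wTabE`), `r` (`wTabR`), `t` (`wTabT`)
(`PeriodPair.blockMaster`):

`Q = ∑ ω_{ij;lm} X_{(A[l],o)}X_{(B[m],o′)} + κ_o ∑ r_{ij;lm} X_{(A[l],∅)}X_{(B[m],o′)}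
     - κ_{o′} ∑ r_{ji;lm} X_{(A[m],o)}X_{(B[l],∅)} + κ_oκ_{o′} ∑ t_{ij;lm} X_{(A[l],∅)}X_{(B[m],∅)}`.

(The tables were found and the whole identity was certified by a computer algebra computation on
the affine model; the Lean proof is the structural one above.) PROVED: `GaGmE.Std.wronskForm`,
`GaGmE.Std.wronsk` (`wronsk_isHomogeneous`) and **`GaGmE.Std.F_wronsk`**.

## References

* Yu. V. Nesterenko, P. Philippon (eds.), *Introduction to Algebraic Independence Theory*,
  LNM 1752, Springer 2001, Ch. 11 (D. Roy), Lemma 3.1. [NesterenkoPhilippon2001]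
* E. T. Whittaker, G. N. Watson, *A Course of Modern Analysis*, 4th ed., CUP 1927, §20.2–20.421.
  [WhittakerWatson1927]
-/

noncomputable section

open Complex Filter Topology MvPolynomial
open scoped PeriodPair ContDiff

namespace Literature.NumberTheory.Transcendental

variable (L : PeriodPair)

/-! ### The tables and the block master identity -/

/-- The table `ω_{ij;lm}` of the block Wronskians `P_jP_i′ - P_iP_j′ = ∑ ω_{ij;lm} P_lP_m` (symmetric in `(l,m)`, antisymmetric in `(i,j)`). [folklore] -/
def _root_.PeriodPair.wTabE (i j l m : Fin 3) : ℂ :=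
  if i = 0 ∧ j = 1 ∧ l = 0 ∧ m = 2 then (-1 / 2 : ℂ) else
  if i = 0 ∧ j = 1 ∧ l = 2 ∧ m = 0 then (-1 / 2 : ℂ) else
  if i = 0 ∧ j = 2 ∧ l = 0 ∧ m = 0 then (1 / 2 : ℂ) * L.g₂ else
  if i = 0 ∧ j = 2 ∧ l = 1 ∧ m = 1 then (-6 : ℂ) else
  if i = 1 ∧ j = 0 ∧ l = 0 ∧ m = 2 then (1 / 2 : ℂ) else
  if i = 1 ∧ j = 0 ∧ l = 2 ∧ m = 0 then (1 / 2 : ℂ) else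
  if i = 1 ∧ j = 2 ∧ l = 0 ∧ m = 0 then (-3 / 2 : ℂ) * L.g₃ else
  if i = 1 ∧ j = 2 ∧ l = 0 ∧ m = 1 then (-1 / 2 : ℂ) * L.g₂ else
  if i = 1 ∧ j = 2 ∧ l = 1 ∧ m = 0 then (-1 / 2 : ℂ) * L.g₂ else
  if i = 1 ∧ j = 2 ∧ l = 2 ∧ m = 2 then (-1 / 2 : ℂ) else
  if i = 2 ∧ j = 0 ∧ l = 0 ∧ m = 0 then (-1 / 2 : ℂ) * L.g₂ else
  if i = 2 ∧ j = 0 ∧ l = 1 ∧ m = 1 then (6 : ℂ) else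
  if i = 2 ∧ j = 1 ∧ l = 0 ∧ m = 0 then (3 / 2 : ℂ) * L.g₃ else
  if i = 2 ∧ j = 1 ∧ l = 0 ∧ m = 1 then (1 / 2 : ℂ) * L.g₂ else
  if i = 2 ∧ j = 1 ∧ l = 1 ∧ m = 0 then (1 / 2 : ℂ) * L.g₂ else
  if i = 2 ∧ j = 1 ∧ l = 2 ∧ m = 2 then (1 / 2 : ℂ) else
  0

/-- The table `r_{ij;lm}` of the `κ`-corrections of the Wronskians of the theta model (ordered pairs `(l,m)`). [folklore] -/
def _root_.PeriodPair.wTabR (i j l m : Fin 3) : ℂ :=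
  if i = 0 ∧ j = 0 ∧ l = 0 ∧ m = 1 then (1 : ℂ) else
  if i = 0 ∧ j = 2 ∧ l = 1 ∧ m = 2 then (1 : ℂ) else
  if i = 1 ∧ j = 0 ∧ l = 1 ∧ m = 1 then (2 : ℂ) else
  if i = 1 ∧ j = 1 ∧ l = 0 ∧ m = 0 then (1 / 4 : ℂ) * L.g₃ else
  if i = 1 ∧ j = 1 ∧ l = 0 ∧ m = 1 then (1 / 4 : ℂ) * L.g₂ else
  if i = 1 ∧ j = 1 ∧ l = 2 ∧ m = 2 then (1 / 4 : ℂ) else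
  if i = 2 ∧ j = 0 ∧ l = 1 ∧ m = 2 then (-3 : ℂ) else
  if i = 2 ∧ j = 2 ∧ l = 0 ∧ m = 1 then (3 : ℂ) * L.g₃ else
  if i = 2 ∧ j = 2 ∧ l = 1 ∧ m = 1 then (2 : ℂ) * L.g₂ else
  0

/-- The table `t_{ij;lm}` of the `κκ′`-corrections of the Wronskians of the theta model. [folklore] -/
def _root_.PeriodPair.wTabT (i j l m : Fin 3) : ℂ :=
  if i = 0 ∧ j = 2 ∧ l = 0 ∧ m = 0 then (3 / 2 : ℂ) * L.g₃ else
  if i = 0 ∧ j = 2 ∧ l = 0 ∧ m = 1 then (3 / 2 : ℂ) * L.g₂ else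
  if i = 0 ∧ j = 2 ∧ l = 2 ∧ m = 2 then (3 / 2 : ℂ) else
  if i = 2 ∧ j = 0 ∧ l = 0 ∧ m = 0 then (-3 / 2 : ℂ) * L.g₃ else
  if i = 2 ∧ j = 0 ∧ l = 0 ∧ m = 1 then (-3 / 2 : ℂ) * L.g₂ else
  if i = 2 ∧ j = 0 ∧ l = 2 ∧ m = 2 then (-3 / 2 : ℂ) else
  0

/-- **The block master identity for `(i, j) = (0, 0)`**: the `z'_b`-Wronskian of two theta
functions with block indices `i, j` at `b`, as a function of the block data
`(Λ, Λ′, a, b, κ, κ′)`, is the value of the quadratic form with tables `ω, r, t`. [folklore] -/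
theorem _root_.PeriodPair.blockMaster_00 {z : ℂ} (hz : z ∉ L.lattice) (Λ Λ' a b κ κ' : ℂ) :
    Λ * Λ' * (L.univExtP 0 z * L.univExtP' 0 z - L.univExtP 0 z * L.univExtP' 0 z) -
        κ * a * Λ' * (L.univExtP 0 z * L.univExtZ' 0 z - L.univExtP' 0 z * L.univExtZ 0 z) +
        κ' * b * Λ * (L.univExtP 0 z * L.univExtZ' 0 z - L.univExtP' 0 z * L.univExtZ 0 z) +
        κ * κ' * a * b * (L.univExtZ 0 z * L.univExtZ' 0 z - L.univExtZ 0 z * L.univExtZ' 0 z) =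
      ∑ l : Fin 3, ∑ m : Fin 3,
        (L.wTabE 0 0 l m * ((L.univExtP l z * Λ - κ * L.univExtZ l z * a) * (L.univExtP m z * Λ' - κ' * L.univExtZ m z * b)) +
          κ * L.wTabR 0 0 l m * ((L.univExtP l z * a) * (L.univExtP m z * Λ' - κ' * L.univExtZ m z * b)) -
          κ' * L.wTabR 0 0 l m * ((L.univExtP m z * Λ - κ * L.univExtZ m z * a) * (L.univExtP l z * b)) +
          κ * κ' * L.wTabT 0 0 l m * ((L.univExtP l z * a) * (L.univExtP m z * b))) := by
  rw [L.wronskP_00 hz, L.wronskPZ_00 hz, L.wronskZ_00 hz]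
  simp [PeriodPair.wTabE, PeriodPair.wTabR, PeriodPair.wTabT, Fin.sum_univ_three]
  ring

/-- **The block master identity for `(i, j) = (0, 1)`**: the `z'_b`-Wronskian of two theta
functions with block indices `i, j` at `b`, as a function of the block data
`(Λ, Λ′, a, b, κ, κ′)`, is the value of the quadratic form with tables `ω, r, t`. [folklore] -/
theorem _root_.PeriodPair.blockMaster_01 {z : ℂ} (hz : z ∉ L.lattice) (Λ Λ' a b κ κ' : ℂ) :
    Λ * Λ' * (L.univExtP 1 z * L.univExtP' 0 z - L.univExtP 0 z * L.univExtP' 1 z) -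
        κ * a * Λ' * (L.univExtP 1 z * L.univExtZ' 0 z - L.univExtP' 1 z * L.univExtZ 0 z) +
        κ' * b * Λ * (L.univExtP 0 z * L.univExtZ' 1 z - L.univExtP' 0 z * L.univExtZ 1 z) +
        κ * κ' * a * b * (L.univExtZ 1 z * L.univExtZ' 0 z - L.univExtZ 0 z * L.univExtZ' 1 z) =
      ∑ l : Fin 3, ∑ m : Fin 3,
        (L.wTabE 0 1 l m * ((L.univExtP l z * Λ - κ * L.univExtZ l z * a) * (L.univExtP m z * Λ' - κ' * L.univExtZ m z * b)) +
          κ * L.wTabR 0 1 l m * ((L.univExtP l z * a) * (L.univExtP m z * Λ' - κ' * L.univExtZ m z * b)) -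
          κ' * L.wTabR 1 0 l m * ((L.univExtP m z * Λ - κ * L.univExtZ m z * a) * (L.univExtP l z * b)) +
          κ * κ' * L.wTabT 0 1 l m * ((L.univExtP l z * a) * (L.univExtP m z * b))) := by
  rw [L.wronskP_01 hz, L.wronskPZ_01 hz, L.wronskPZ_10 hz, L.wronskZ_01 hz]
  simp [PeriodPair.wTabE, PeriodPair.wTabR, PeriodPair.wTabT, Fin.sum_univ_three]
  ring

/-- **The block master identity for `(i, j) = (0, 2)`**: the `z'_b`-Wronskian of two theta
functions with block indices `i, j` at `b`, as a function of the block data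
`(Λ, Λ′, a, b, κ, κ′)`, is the value of the quadratic form with tables `ω, r, t`. [folklore] -/
theorem _root_.PeriodPair.blockMaster_02 {z : ℂ} (hz : z ∉ L.lattice) (Λ Λ' a b κ κ' : ℂ) :
    Λ * Λ' * (L.univExtP 2 z * L.univExtP' 0 z - L.univExtP 0 z * L.univExtP' 2 z) -
        κ * a * Λ' * (L.univExtP 2 z * L.univExtZ' 0 z - L.univExtP' 2 z * L.univExtZ 0 z) +
        κ' * b * Λ * (L.univExtP 0 z * L.univExtZ' 2 z - L.univExtP' 0 z * L.univExtZ 2 z) +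
        κ * κ' * a * b * (L.univExtZ 2 z * L.univExtZ' 0 z - L.univExtZ 0 z * L.univExtZ' 2 z) =
      ∑ l : Fin 3, ∑ m : Fin 3,
        (L.wTabE 0 2 l m * ((L.univExtP l z * Λ - κ * L.univExtZ l z * a) * (L.univExtP m z * Λ' - κ' * L.univExtZ m z * b)) +
          κ * L.wTabR 0 2 l m * ((L.univExtP l z * a) * (L.univExtP m z * Λ' - κ' * L.univExtZ m z * b)) -
          κ' * L.wTabR 2 0 l m * ((L.univExtP m z * Λ - κ * L.univExtZ m z * a) * (L.univExtP l z * b)) +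
          κ * κ' * L.wTabT 0 2 l m * ((L.univExtP l z * a) * (L.univExtP m z * b))) := by
  rw [L.wronskP_02 hz, L.wronskPZ_02 hz, L.wronskPZ_20 hz, L.wronskZ_02 hz]
  simp [PeriodPair.wTabE, PeriodPair.wTabR, PeriodPair.wTabT, Fin.sum_univ_three]
  ring

/-- **The block master identity for `(i, j) = (1, 0)`**: the `z'_b`-Wronskian of two theta
functions with block indices `i, j` at `b`, as a function of the block data
`(Λ, Λ′, a, b, κ, κ′)`, is the value of the quadratic form with tables `ω, r, t`. [folklore] -/
theorem _root_.PeriodPair.blockMaster_10 {z : ℂ} (hz : z ∉ L.lattice) (Λ Λ' a b κ κ' : ℂ) :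
    Λ * Λ' * (L.univExtP 0 z * L.univExtP' 1 z - L.univExtP 1 z * L.univExtP' 0 z) -
        κ * a * Λ' * (L.univExtP 0 z * L.univExtZ' 1 z - L.univExtP' 0 z * L.univExtZ 1 z) +
        κ' * b * Λ * (L.univExtP 1 z * L.univExtZ' 0 z - L.univExtP' 1 z * L.univExtZ 0 z) +
        κ * κ' * a * b * (L.univExtZ 0 z * L.univExtZ' 1 z - L.univExtZ 1 z * L.univExtZ' 0 z) =
      ∑ l : Fin 3, ∑ m : Fin 3,
        (L.wTabE 1 0 l m * ((L.univExtP l z * Λ - κ * L.univExtZ l z * a) * (L.univExtP m z * Λ' - κ' * L.univExtZ m z * b)) +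
          κ * L.wTabR 1 0 l m * ((L.univExtP l z * a) * (L.univExtP m z * Λ' - κ' * L.univExtZ m z * b)) -
          κ' * L.wTabR 0 1 l m * ((L.univExtP m z * Λ - κ * L.univExtZ m z * a) * (L.univExtP l z * b)) +
          κ * κ' * L.wTabT 1 0 l m * ((L.univExtP l z * a) * (L.univExtP m z * b))) := by
  rw [L.wronskP_10 hz, L.wronskPZ_10 hz, L.wronskPZ_01 hz, L.wronskZ_10 hz]
  simp [PeriodPair.wTabE, PeriodPair.wTabR, PeriodPair.wTabT, Fin.sum_univ_three]
  ring

/-- **The block master identity for `(i, j) = (1, 1)`**: the `z'_b`-Wronskian of two theta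
functions with block indices `i, j` at `b`, as a function of the block data
`(Λ, Λ′, a, b, κ, κ′)`, is the value of the quadratic form with tables `ω, r, t`. [folklore] -/
theorem _root_.PeriodPair.blockMaster_11 {z : ℂ} (hz : z ∉ L.lattice) (Λ Λ' a b κ κ' : ℂ) :
    Λ * Λ' * (L.univExtP 1 z * L.univExtP' 1 z - L.univExtP 1 z * L.univExtP' 1 z) -
        κ * a * Λ' * (L.univExtP 1 z * L.univExtZ' 1 z - L.univExtP' 1 z * L.univExtZ 1 z) +
        κ' * b * Λ * (L.univExtP 1 z * L.univExtZ' 1 z - L.univExtP' 1 z * L.univExtZ 1 z) +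
        κ * κ' * a * b * (L.univExtZ 1 z * L.univExtZ' 1 z - L.univExtZ 1 z * L.univExtZ' 1 z) =
      ∑ l : Fin 3, ∑ m : Fin 3,
        (L.wTabE 1 1 l m * ((L.univExtP l z * Λ - κ * L.univExtZ l z * a) * (L.univExtP m z * Λ' - κ' * L.univExtZ m z * b)) +
          κ * L.wTabR 1 1 l m * ((L.univExtP l z * a) * (L.univExtP m z * Λ' - κ' * L.univExtZ m z * b)) -
          κ' * L.wTabR 1 1 l m * ((L.univExtP m z * Λ - κ * L.univExtZ m z * a) * (L.univExtP l z * b)) +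
          κ * κ' * L.wTabT 1 1 l m * ((L.univExtP l z * a) * (L.univExtP m z * b))) := by
  rw [L.wronskP_11 hz, L.wronskPZ_11 hz, L.wronskZ_11 hz]
  simp [PeriodPair.wTabE, PeriodPair.wTabR, PeriodPair.wTabT, Fin.sum_univ_three]
  ring

/-- **The block master identity for `(i, j) = (1, 2)`**: the `z'_b`-Wronskian of two theta
functions with block indices `i, j` at `b`, as a function of the block data
`(Λ, Λ′, a, b, κ, κ′)`, is the value of the quadratic form with tables `ω, r, t`. [folklore] -/
theorem _root_.PeriodPair.blockMaster_12 {z : ℂ} (hz : z ∉ L.lattice) (Λ Λ' a b κ κ' : ℂ) :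
    Λ * Λ' * (L.univExtP 2 z * L.univExtP' 1 z - L.univExtP 1 z * L.univExtP' 2 z) -
        κ * a * Λ' * (L.univExtP 2 z * L.univExtZ' 1 z - L.univExtP' 2 z * L.univExtZ 1 z) +
        κ' * b * Λ * (L.univExtP 1 z * L.univExtZ' 2 z - L.univExtP' 1 z * L.univExtZ 2 z) +
        κ * κ' * a * b * (L.univExtZ 2 z * L.univExtZ' 1 z - L.univExtZ 1 z * L.univExtZ' 2 z) =
      ∑ l : Fin 3, ∑ m : Fin 3,
        (L.wTabE 1 2 l m * ((L.univExtP l z * Λ - κ * L.univExtZ l z * a) * (L.univExtP m z * Λ' - κ' * L.univExtZ m z * b)) +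
          κ * L.wTabR 1 2 l m * ((L.univExtP l z * a) * (L.univExtP m z * Λ' - κ' * L.univExtZ m z * b)) -
          κ' * L.wTabR 2 1 l m * ((L.univExtP m z * Λ - κ * L.univExtZ m z * a) * (L.univExtP l z * b)) +
          κ * κ' * L.wTabT 1 2 l m * ((L.univExtP l z * a) * (L.univExtP m z * b))) := by
  rw [L.wronskP_12 hz, L.wronskPZ_12 hz, L.wronskPZ_21 hz, L.wronskZ_12 hz]
  simp [PeriodPair.wTabE, PeriodPair.wTabR, PeriodPair.wTabT, Fin.sum_univ_three]
  ring

/-- **The block master identity for `(i, j) = (2, 0)`**: the `z'_b`-Wronskian of two theta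
functions with block indices `i, j` at `b`, as a function of the block data
`(Λ, Λ′, a, b, κ, κ′)`, is the value of the quadratic form with tables `ω, r, t`. [folklore] -/
theorem _root_.PeriodPair.blockMaster_20 {z : ℂ} (hz : z ∉ L.lattice) (Λ Λ' a b κ κ' : ℂ) :
    Λ * Λ' * (L.univExtP 0 z * L.univExtP' 2 z - L.univExtP 2 z * L.univExtP' 0 z) -
        κ * a * Λ' * (L.univExtP 0 z * L.univExtZ' 2 z - L.univExtP' 0 z * L.univExtZ 2 z) +
        κ' * b * Λ * (L.univExtP 2 z * L.univExtZ' 0 z - L.univExtP' 2 z * L.univExtZ 0 z) +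
        κ * κ' * a * b * (L.univExtZ 0 z * L.univExtZ' 2 z - L.univExtZ 2 z * L.univExtZ' 0 z) =
      ∑ l : Fin 3, ∑ m : Fin 3,
        (L.wTabE 2 0 l m * ((L.univExtP l z * Λ - κ * L.univExtZ l z * a) * (L.univExtP m z * Λ' - κ' * L.univExtZ m z * b)) +
          κ * L.wTabR 2 0 l m * ((L.univExtP l z * a) * (L.univExtP m z * Λ' - κ' * L.univExtZ m z * b)) -
          κ' * L.wTabR 0 2 l m * ((L.univExtP m z * Λ - κ * L.univExtZ m z * a) * (L.univExtP l z * b)) +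
          κ * κ' * L.wTabT 2 0 l m * ((L.univExtP l z * a) * (L.univExtP m z * b))) := by
  rw [L.wronskP_20 hz, L.wronskPZ_20 hz, L.wronskPZ_02 hz, L.wronskZ_20 hz]
  simp [PeriodPair.wTabE, PeriodPair.wTabR, PeriodPair.wTabT, Fin.sum_univ_three]
  ring

/-- **The block master identity for `(i, j) = (2, 1)`**: the `z'_b`-Wronskian of two theta
functions with block indices `i, j` at `b`, as a function of the block data
`(Λ, Λ′, a, b, κ, κ′)`, is the value of the quadratic form with tables `ω, r, t`. [folklore] -/
theorem _root_.PeriodPair.blockMaster_21 {z : ℂ} (hz : z ∉ L.lattice) (Λ Λ' a b κ κ' : ℂ) :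
    Λ * Λ' * (L.univExtP 1 z * L.univExtP' 2 z - L.univExtP 2 z * L.univExtP' 1 z) -
        κ * a * Λ' * (L.univExtP 1 z * L.univExtZ' 2 z - L.univExtP' 1 z * L.univExtZ 2 z) +
        κ' * b * Λ * (L.univExtP 2 z * L.univExtZ' 1 z - L.univExtP' 2 z * L.univExtZ 1 z) +
        κ * κ' * a * b * (L.univExtZ 1 z * L.univExtZ' 2 z - L.univExtZ 2 z * L.univExtZ' 1 z) =
      ∑ l : Fin 3, ∑ m : Fin 3,
        (L.wTabE 2 1 l m * ((L.univExtP l z * Λ - κ * L.univExtZ l z * a) * (L.univExtP m z * Λ' - κ' * L.univExtZ m z * b)) +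
          κ * L.wTabR 2 1 l m * ((L.univExtP l z * a) * (L.univExtP m z * Λ' - κ' * L.univExtZ m z * b)) -
          κ' * L.wTabR 1 2 l m * ((L.univExtP m z * Λ - κ * L.univExtZ m z * a) * (L.univExtP l z * b)) +
          κ * κ' * L.wTabT 2 1 l m * ((L.univExtP l z * a) * (L.univExtP m z * b))) := by
  rw [L.wronskP_21 hz, L.wronskPZ_21 hz, L.wronskPZ_12 hz, L.wronskZ_21 hz]
  simp [PeriodPair.wTabE, PeriodPair.wTabR, PeriodPair.wTabT, Fin.sum_univ_three]
  ring

/-- **The block master identity for `(i, j) = (2, 2)`**: the `z'_b`-Wronskian of two theta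
functions with block indices `i, j` at `b`, as a function of the block data
`(Λ, Λ′, a, b, κ, κ′)`, is the value of the quadratic form with tables `ω, r, t`. [folklore] -/
theorem _root_.PeriodPair.blockMaster_22 {z : ℂ} (hz : z ∉ L.lattice) (Λ Λ' a b κ κ' : ℂ) :
    Λ * Λ' * (L.univExtP 2 z * L.univExtP' 2 z - L.univExtP 2 z * L.univExtP' 2 z) -
        κ * a * Λ' * (L.univExtP 2 z * L.univExtZ' 2 z - L.univExtP' 2 z * L.univExtZ 2 z) +
        κ' * b * Λ * (L.univExtP 2 z * L.univExtZ' 2 z - L.univExtP' 2 z * L.univExtZ 2 z) +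
        κ * κ' * a * b * (L.univExtZ 2 z * L.univExtZ' 2 z - L.univExtZ 2 z * L.univExtZ' 2 z) =
      ∑ l : Fin 3, ∑ m : Fin 3,
        (L.wTabE 2 2 l m * ((L.univExtP l z * Λ - κ * L.univExtZ l z * a) * (L.univExtP m z * Λ' - κ' * L.univExtZ m z * b)) +
          κ * L.wTabR 2 2 l m * ((L.univExtP l z * a) * (L.univExtP m z * Λ' - κ' * L.univExtZ m z * b)) -
          κ' * L.wTabR 2 2 l m * ((L.univExtP m z * Λ - κ * L.univExtZ m z * a) * (L.univExtP l z * b)) +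
          κ * κ' * L.wTabT 2 2 l m * ((L.univExtP l z * a) * (L.univExtP m z * b))) := by
  rw [L.wronskP_22 hz, L.wronskPZ_22 hz, L.wronskZ_22 hz]
  simp [PeriodPair.wTabE, PeriodPair.wTabR, PeriodPair.wTabT, Fin.sum_univ_three]
  ring

/-- **The block master identity** (all `i, j`). [folklore] -/
theorem _root_.PeriodPair.blockMaster (i j : Fin 3) {z : ℂ} (hz : z ∉ L.lattice) (Λ Λ' a b κ κ' : ℂ) :
    Λ * Λ' * (L.univExtP j z * L.univExtP' i z - L.univExtP i z * L.univExtP' j z) -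
        κ * a * Λ' * (L.univExtP j z * L.univExtZ' i z - L.univExtP' j z * L.univExtZ i z) +
        κ' * b * Λ * (L.univExtP i z * L.univExtZ' j z - L.univExtP' i z * L.univExtZ j z) +
        κ * κ' * a * b * (L.univExtZ j z * L.univExtZ' i z - L.univExtZ i z * L.univExtZ' j z) =
      ∑ l : Fin 3, ∑ m : Fin 3,
        (L.wTabE i j l m * ((L.univExtP l z * Λ - κ * L.univExtZ l z * a) * (L.univExtP m z * Λ' - κ' * L.univExtZ m z * b)) +
          κ * L.wTabR i j l m * ((L.univExtP l z * a) * (L.univExtP m z * Λ' - κ' * L.univExtZ m z * b)) -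
          κ' * L.wTabR j i l m * ((L.univExtP m z * Λ - κ * L.univExtZ m z * a) * (L.univExtP l z * b)) +
          κ * κ' * L.wTabT i j l m * ((L.univExtP l z * a) * (L.univExtP m z * b))) := by
  fin_cases i <;> fin_cases j
  exacts [L.blockMaster_00 hz Λ Λ' a b κ κ', L.blockMaster_01 hz Λ Λ' a b κ κ', L.blockMaster_02 hz Λ Λ' a b κ κ',
    L.blockMaster_10 hz Λ Λ' a b κ κ', L.blockMaster_11 hz Λ Λ' a b κ κ', L.blockMaster_12 hz Λ Λ' a b κ κ',
    L.blockMaster_20 hz Λ Λ' a b κ κ', L.blockMaster_21 hz Λ Λ' a b κ κ', L.blockMaster_22 hz Λ Λ' a b κ κ']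

namespace GaGmE

namespace Std

variable {β γ δ : Type} [Fintype β] [Fintype γ] [Fintype δ] [DecidableEq γ] [DecidableEq β] [DecidableEq δ]
variable (κM : δ → γ → Kbar)

/-! ### The block decomposition of the theta functions of `P_κ` at a block `b` -/

/-- **The other-blocks factor** `a(A, b; w) = ∏_{c ≠ b} P_{A c}(z'_c)`. [folklore] -/
def aFac (A : γ → Fin 3) (b : γ) (w : β ⊕ (γ ⊕ δ) → ℂ) : ℂ :=
  ∏ c ∈ Finset.univ.erase b, L.univExtP (A c) (w (iz c))

/-- **The fibre weight of a tag at a block**: `κ_{none,b} = 0`, `κ_{some e,b} = κ_{eb}`. [folklore] -/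
def kapO (o : Option δ) (b : γ) : ℂ := o.elim 0 fun e => (κM e b : ℂ)

/-- **The `Λ`-factor** `Λ(A, o, b; w)`: `a` for `o = none`, and
`s_e a - ∑_{c≠b} κ_{ec} Z_{A c}(z'_c) ∏_{c'∉{b,c}} P_{A c'}(z'_{c'})` for `o = some e`. [folklore] -/
def lamFac (A : γ → Fin 3) (o : Option δ) (b : γ) (w : β ⊕ (γ ⊕ δ) → ℂ) : ℂ :=
  o.elim (aFac L A b w) fun e =>
    w (is e) * aFac L A b w -
      ∑ c ∈ Finset.univ.erase b, (κM e c : ℂ) *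
        (L.univExtZ (A c) (w (iz c)) * ∏ c' ∈ (Finset.univ.erase b).erase c, L.univExtP (A c') (w (iz c')))

omit [Fintype β] [Fintype γ] [Fintype δ] [DecidableEq γ] [DecidableEq β] [DecidableEq δ] in
/-- `κ_{none} = 0`. [folklore] -/
@[simp] theorem kapO_none (b : γ) : kapO κM (none : Option δ) b = 0 := rfl

omit [Fintype β] [Fintype γ] [Fintype δ] [DecidableEq γ] [DecidableEq β] [DecidableEq δ] in
/-- `κ_{some e} = κ_{eb}`. [folklore] -/
@[simp] theorem kapO_some (e : δ) (b : γ) : kapO κM (some e) b = (κM e b : ℂ) := rfl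

omit [Fintype β] [Fintype δ] [DecidableEq β] [DecidableEq δ] in
/-- `Λ(A, none) = a(A)`. [folklore] -/
@[simp] theorem lamFac_none (A : γ → Fin 3) (b : γ) (w : β ⊕ (γ ⊕ δ) → ℂ) :
    lamFac L κM A (none : Option δ) b w = aFac L A b w := rfl

omit [Fintype β] [Fintype δ] [DecidableEq β] [DecidableEq δ] in
/-- `Λ(A, some e)`. [folklore] -/
theorem lamFac_some (A : γ → Fin 3) (e : δ) (b : γ) (w : β ⊕ (γ ⊕ δ) → ℂ) :
    lamFac L κM A (some e) b w = w (is e) * aFac L A b w -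
      ∑ c ∈ Finset.univ.erase b, (κM e c : ℂ) *
        (L.univExtZ (A c) (w (iz c)) * ∏ c' ∈ (Finset.univ.erase b).erase c, L.univExtP (A c') (w (iz c'))) := rfl

omit [Fintype β] [Fintype δ] [DecidableEq β] [DecidableEq δ] in
/-- **The block decomposition**: `Θ^P_{(A,o)} = P_{A_b}(z'_b) Λ(A,o,b) - κ_{o,b} Z_{A_b}(z'_b) a(A,b)`.
[folklore] -/
theorem thetaP_eq_decomp (A : γ → Fin 3) (o : Option δ) (b : γ) (w : β ⊕ (γ ⊕ δ) → ℂ) :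
    thetaP (β := β) L κM (A, o) w =
      L.univExtP (A b) (w (iz b)) * lamFac L κM A o b w - kapO κM o b * L.univExtZ (A b) (w (iz b)) * aFac L A b w := by
  rcases o with _ | e
  · simp only [thetaP_none, lamFac_none, kapO_none, zero_mul, sub_zero, aFac]
    exact thetaPnone_eq_mul_erase L A b w
  · simp only [thetaP_some, lamFac_some, kapO_some]
    unfold thetaPsome
    rw [thetaPnone_eq_mul_erase L A b w, ← Finset.add_sum_erase _ _ (Finset.mem_univ b)]
    have hsplit : ∀ c ∈ Finset.univ.erase b,
        (κM e c : ℂ) * (L.univExtZ (A c) (w (iz c)) * ∏ b' ∈ Finset.univ.erase c, L.univExtP (A b') (w (iz b'))) =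
        L.univExtP (A b) (w (iz b)) * ((κM e c : ℂ) *
          (L.univExtZ (A c) (w (iz c)) * ∏ c' ∈ (Finset.univ.erase b).erase c, L.univExtP (A c') (w (iz c')))) := by
      intro c hc
      have hbc : b ∈ Finset.univ.erase c := Finset.mem_erase.mpr ⟨(Finset.ne_of_mem_erase hc).symm, Finset.mem_univ b⟩
      rw [← Finset.mul_prod_erase _ _ hbc, Finset.erase_right_comm]
      ring
    rw [Finset.sum_congr rfl hsplit, ← Finset.mul_sum]
    unfold aFac
    ring

omit [Fintype β] [Fintype δ] [DecidableEq β] [DecidableEq δ] in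
/-- `a` does not see the modified block. [folklore] -/
theorem aFac_update_idx (A : γ → Fin 3) (b : γ) (l : Fin 3) (w : β ⊕ (γ ⊕ δ) → ℂ) :
    aFac L (Function.update A b l) b w = aFac L A b w := by
  unfold aFac
  exact Finset.prod_congr rfl fun c hc => by rw [Function.update_of_ne (Finset.ne_of_mem_erase hc)]

omit [Fintype β] [Fintype δ] [DecidableEq β] [DecidableEq δ] in
/-- `Λ` does not see the modified block. [folklore] -/
theorem lamFac_update_idx (A : γ → Fin 3) (o : Option δ) (b : γ) (l : Fin 3) (w : β ⊕ (γ ⊕ δ) → ℂ) :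
    lamFac L κM (Function.update A b l) o b w = lamFac L κM A o b w := by
  rcases o with _ | e
  · simp only [lamFac_none, aFac_update_idx]
  · simp only [lamFac_some, aFac_update_idx]
    congr 1
    refine Finset.sum_congr rfl fun c hc => ?_
    rw [Function.update_of_ne (Finset.ne_of_mem_erase hc)]
    congr 2
    exact Finset.prod_congr rfl fun c' hc' => by
      rw [Function.update_of_ne (Finset.ne_of_mem_erase (Finset.mem_of_mem_erase hc'))]

omit [Fintype β] [Fintype γ] [Fintype δ] [DecidableEq γ] [DecidableEq β] [DecidableEq δ] in
/-- `iz` is injective. [folklore] -/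
theorem iz_ne_iz {b c : γ} (h : c ≠ b) : (iz c : β ⊕ (γ ⊕ δ)) ≠ iz b := by
  simpa [iz] using h

omit [Fintype β] [Fintype γ] [Fintype δ] [DecidableEq γ] [DecidableEq β] [DecidableEq δ] in
/-- `is e ≠ iz b`. [folklore] -/
theorem is_ne_iz (e : δ) (b : γ) : (is e : β ⊕ (γ ⊕ δ)) ≠ iz b := by
  simp [is, iz]

omit [Fintype β] [Fintype γ] [Fintype δ] [DecidableEq γ] [DecidableEq β] [DecidableEq δ] in
/-- `iy j ≠ iz b`. [folklore] -/
theorem iy_ne_iz (j : β) (b : γ) : (iy j : β ⊕ (γ ⊕ δ)) ≠ iz b := by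
  simp [iy, iz]

omit [Fintype β] [Fintype δ] in
/-- `a` does not see the `b`-coordinate of the point. [folklore] -/
theorem aFac_update_pt (A : γ → Fin 3) (b : γ) (w : β ⊕ (γ ⊕ δ) → ℂ) (v : ℂ) :
    aFac L A b (Function.update w (iz b) v) = aFac L A b w := by
  unfold aFac
  exact Finset.prod_congr rfl fun c hc => by rw [Function.update_of_ne (iz_ne_iz (Finset.ne_of_mem_erase hc))]

omit [Fintype β] [Fintype δ] in
/-- `Λ` does not see the `b`-coordinate of the point. [folklore] -/
theorem lamFac_update_pt (A : γ → Fin 3) (o : Option δ) (b : γ) (w : β ⊕ (γ ⊕ δ) → ℂ) (v : ℂ) :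
    lamFac L κM A o b (Function.update w (iz b) v) = lamFac L κM A o b w := by
  rcases o with _ | e
  · simp only [lamFac_none, aFac_update_pt]
  · simp only [lamFac_some, aFac_update_pt, Function.update_of_ne (is_ne_iz (β := β) e b)]
    congr 1
    refine Finset.sum_congr rfl fun c hc => ?_
    rw [Function.update_of_ne (iz_ne_iz (Finset.ne_of_mem_erase hc))]
    congr 2
    exact Finset.prod_congr rfl fun c' hc' => by
      rw [Function.update_of_ne (iz_ne_iz (Finset.ne_of_mem_erase (Finset.mem_of_mem_erase hc')))]

omit [Fintype β] [Fintype δ] in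
/-- **The modified theta function at a moved point**:
`Θ^P_{(A[b↦l],o)}(w[z'_b ↦ v]) = P_l(v) Λ(A,o,b;w) - κ_{o,b} Z_l(v) a(A,b;w)`. [folklore] -/
theorem thetaP_update_update (A : γ → Fin 3) (o : Option δ) (b : γ) (l : Fin 3) (w : β ⊕ (γ ⊕ δ) → ℂ) (v : ℂ) :
    thetaP (β := β) L κM (Function.update A b l, o) (Function.update w (iz b) v) =
      L.univExtP l v * lamFac L κM A o b w - kapO κM o b * L.univExtZ l v * aFac L A b w := by
  rw [thetaP_eq_decomp L κM _ o b, Function.update_self, Function.update_self, lamFac_update_pt, aFac_update_pt,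
    lamFac_update_idx, aFac_update_idx]

omit [Fintype β] [Fintype δ] in
/-- The modified theta function at the point itself. [folklore] -/
theorem thetaP_update_eq (A : γ → Fin 3) (o : Option δ) (b : γ) (l : Fin 3) (w : β ⊕ (γ ⊕ δ) → ℂ) :
    thetaP (β := β) L κM (Function.update A b l, o) w =
      L.univExtP l (w (iz b)) * lamFac L κM A o b w - kapO κM o b * L.univExtZ l (w (iz b)) * aFac L A b w := by
  have h := thetaP_update_update L κM A o b l w (w (iz b))
  rwa [Function.update_eq_self] at h

/-! ### Lines along the coordinate directions -/

omit [Fintype β] [Fintype γ] [Fintype δ] in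
/-- The coordinate line `w + t e_k` is the update of the `k`-th coordinate. [folklore] -/
theorem line_single_eq_update (w : β ⊕ (γ ⊕ δ) → ℂ) (k : β ⊕ (γ ⊕ δ)) (t : ℂ) :
    w + t • (Pi.single k (1 : ℂ) : β ⊕ (γ ⊕ δ) → ℂ) = Function.update w k (w k + t) := by
  funext k'
  by_cases h : k' = k
  · subst h; simp
  · simp [Pi.single_eq_of_ne h, Function.update_of_ne h]

omit [Fintype β] [Fintype γ] [Fintype δ] in
/-- The torus coordinates do not see the `E`-coordinates. [folklore] -/
theorem thetaT_update_iz (a : Option β) (w : β ⊕ (γ ⊕ δ) → ℂ) (b : γ) (v : ℂ) :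
    thetaT (γ := γ) (δ := δ) a (Function.update w (iz b) v) = thetaT a w := by
  rcases a with _ | j
  · rfl
  · simp only [thetaT_some, Function.update_of_ne (iy_ne_iz (δ := δ) j b)]

omit [Fintype β] [Fintype δ] in
/-- **The derivative of a theta function of `P_κ` along `z'_b`**:
`d/dt Θ^P_{(A,o)}(w + t e_{z_b})|₀ = P′_{A_b}(z'_b) Λ - κ_{o,b} Z′_{A_b}(z'_b) a`. [folklore] -/
theorem hasDerivAt_thetaP_iz (A : γ → Fin 3) (o : Option δ) (b : γ)
    (w : β ⊕ (γ ⊕ δ) → ℂ) :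
    HasDerivAt (fun t : ℂ => thetaP (β := β) L κM (A, o) (w + t • (Pi.single (iz b) (1 : ℂ) : β ⊕ (γ ⊕ δ) → ℂ)))
      (L.univExtP' (A b) (w (iz b)) * lamFac L κM A o b w -
        kapO κM o b * L.univExtZ' (A b) (w (iz b)) * aFac L A b w) 0 := by
  have hfun : (fun t : ℂ => thetaP (β := β) L κM (A, o) (w + t • (Pi.single (iz b) (1 : ℂ) : β ⊕ (γ ⊕ δ) → ℂ))) =
      fun t => L.univExtP (A b) (w (iz b) + t) * lamFac L κM A o b w -
        kapO κM o b * L.univExtZ (A b) (w (iz b) + t) * aFac L A b w := by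
    funext t
    rw [line_single_eq_update]
    have h := thetaP_update_update L κM A o b (A b) w (w (iz b) + t)
    rwa [Function.update_eq_self] at h
  rw [hfun]
  have hg : HasDerivAt (fun t : ℂ => w (iz b) + t) 1 0 := by simpa using (hasDerivAt_id (0 : ℂ)).const_add (w (iz b))
  have hP : HasDerivAt (fun t : ℂ => L.univExtP (A b) (w (iz b) + t)) (L.univExtP' (A b) (w (iz b))) 0 := by
    have h := (L.hasDerivAt_univExtP (A b) (w (iz b) + 0)).comp 0 hg
    simpa [Function.comp_def] using h
  have hZ : HasDerivAt (fun t : ℂ => L.univExtZ (A b) (w (iz b) + t)) (L.univExtZ' (A b) (w (iz b))) 0 := by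
    have h := (L.hasDerivAt_univExtZ (A b) (w (iz b) + 0)).comp 0 hg
    simpa [Function.comp_def] using h
  exact (hP.mul_const _).sub ((hZ.const_mul _).mul_const _)

/-! ### Derivatives of the theta functions of `M_κ` along the coordinate directions -/

omit [Fintype β] [Fintype δ] in
/-- The theta functions of `P_κ` do not see the torus coordinates. [folklore] -/
theorem thetaP_update_iy (I : ThetaIdx γ δ) (w : β ⊕ (γ ⊕ δ) → ℂ) (j : β) (v : ℂ) :
    thetaP (β := β) L κM I (Function.update w (iy j) v) = thetaP L κM I w := by
  have hz : ∀ c : γ, Function.update w (iy j) v (iz c) = w (iz c) := fun c =>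
    Function.update_of_ne (by simp [iy, iz]) _ _
  obtain ⟨A, _ | e⟩ := I
  · simp only [thetaP_none, thetaPnone, hz]
  · have hs : Function.update w (iy j) v (is e) = w (is e) := Function.update_of_ne (by simp [iy, is]) _ _
    simp only [thetaP_some, thetaPsome, thetaPnone, hz, hs]

omit [Fintype β] [Fintype δ] in
/-- **Along a torus coordinate**: `d/dt Θ_{(a,I)}(w + t e_{y_j})|₀ = [a = j] Θ_{(a,I)}(w)`. [folklore] -/
theorem hasDerivAt_theta_iy (a : Option β) (I : ThetaIdx γ δ) (w : β ⊕ (γ ⊕ δ) → ℂ) (j : β) :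
    HasDerivAt (fun t : ℂ => theta L κM (a, I) (w + t • (Pi.single (iy j) (1 : ℂ) : β ⊕ (γ ⊕ δ) → ℂ)))
      ((if a = some j then 1 else 0) * theta L κM (a, I) w) 0 := by
  simp only [line_single_eq_update, theta, thetaP_update_iy]
  rcases a with _ | j'
  · simp only [thetaT_none, one_mul, reduceCtorEq, if_false, zero_mul]
    exact hasDerivAt_const _ _
  · by_cases hj : j' = j
    · subst hj
      simp only [thetaT_some, Function.update_self, if_true, one_mul]
      have h : HasDerivAt (fun t : ℂ => cexp (w (iy j') + t)) (cexp (w (iy j'))) 0 := by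
        simpa using ((hasDerivAt_id (0 : ℂ)).const_add (w (iy j'))).cexp
      exact h.mul_const _
    · have hne : (iy j' : β ⊕ (γ ⊕ δ)) ≠ iy j := by simpa [iy] using hj
      simp only [thetaT_some, Function.update_of_ne hne, Option.some.injEq, hj, if_false, zero_mul]
      exact hasDerivAt_const _ _

omit [Fintype β] [Fintype δ] in
/-- **Along a fibre coordinate**: `d/dt Θ_{(a,(A,o))}(w + t e_{s_e})|₀ = [o = e] Θ_{(a,(A,∅))}(w)`. [folklore] -/
theorem hasDerivAt_theta_is (a : Option β) (A : γ → Fin 3) (o : Option δ) (w : β ⊕ (γ ⊕ δ) → ℂ) (e : δ) :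
    HasDerivAt (fun t : ℂ => theta L κM (a, (A, o)) (w + t • (Pi.single (is e) (1 : ℂ) : β ⊕ (γ ⊕ δ) → ℂ)))
      ((if o = some e then 1 else 0) * theta L κM (a, (A, none)) w) 0 := by
  have hz : ∀ (v : ℂ) (c : γ), Function.update w (is e) v (iz c) = w (iz c) := fun v c =>
    Function.update_of_ne (by simp [is, iz]) _ _
  have hy : ∀ v : ℂ, thetaT (γ := γ) (δ := δ) a (Function.update w (is e) v) = thetaT a w := by
    intro v
    rcases a with _ | j
    · rfl
    · simp only [thetaT_some, Function.update_of_ne (show (iy j : β ⊕ (γ ⊕ δ)) ≠ is e by simp [iy, is])]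
  simp only [line_single_eq_update, theta, hy, thetaP_none]
  rcases o with _ | e'
  · simp only [thetaP_none, thetaPnone, hz, reduceCtorEq, if_false, zero_mul]
    exact hasDerivAt_const _ _
  · simp only [thetaP_some, thetaPsome, thetaPnone, hz, Option.some.injEq]
    by_cases he : e' = e
    · subst he
      simp only [Function.update_self, if_true, one_mul]
      have h1 : HasDerivAt (fun t : ℂ => w (is e') + t) 1 0 := by simpa using (hasDerivAt_id (0 : ℂ)).const_add (w (is e'))
      have h2 := ((h1.mul_const (∏ b, L.univExtP (A b) (w (iz b)))).sub_const
        (∑ b, (κM e' b : ℂ) * (L.univExtZ (A b) (w (iz b)) * ∏ b' ∈ Finset.univ.erase b, L.univExtP (A b') (w (iz b'))))).const_mul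
        (thetaT (γ := γ) (δ := δ) a w)
      simpa using h2
    · have hne : (is e' : β ⊕ (γ ⊕ δ)) ≠ is e := by simpa [is] using he
      simp only [Function.update_of_ne hne, he, if_false, zero_mul]
      exact hasDerivAt_const _ _

omit [Fintype β] [Fintype δ] in
/-- **Along an `E`-coordinate**: `d/dt Θ_{(a,(A,o))}(w + t e_{z_b})|₀ = T_a (P′_{A_b} Λ - κ_{o,b} Z′_{A_b} a)`. [folklore] -/
theorem hasDerivAt_theta_iz (a : Option β) (A : γ → Fin 3) (o : Option δ) (b : γ) (w : β ⊕ (γ ⊕ δ) → ℂ) :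
    HasDerivAt (fun t : ℂ => theta L κM (a, (A, o)) (w + t • (Pi.single (iz b) (1 : ℂ) : β ⊕ (γ ⊕ δ) → ℂ)))
      (thetaT (γ := γ) (δ := δ) a w * (L.univExtP' (A b) (w (iz b)) * lamFac L κM A o b w -
        kapO κM o b * L.univExtZ' (A b) (w (iz b)) * aFac L A b w)) 0 := by
  have hT : ∀ t : ℂ, thetaT (γ := γ) (δ := δ) a (w + t • (Pi.single (iz b) (1 : ℂ) : β ⊕ (γ ⊕ δ) → ℂ)) = thetaT a w := by
    intro t
    rw [line_single_eq_update, thetaT_update_iz]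
  simp only [theta, hT]
  exact (hasDerivAt_thetaP_iz L κM A o b w).const_mul _

/-! ### The derivative along a general direction -/

/-- **The derivative along `x` is the sum of the coordinate derivatives** (chain rule; `x = ∑ x_k e_k`).
[folklore] -/
theorem deriv_line_eq_sum {f : (β ⊕ (γ ⊕ δ) → ℂ) → ℂ} (hf : Differentiable ℂ f) (w x : β ⊕ (γ ⊕ δ) → ℂ) :
    deriv (fun t : ℂ => f (w + t • x)) 0 =
      ∑ k, x k * deriv (fun t : ℂ => f (w + t • (Pi.single k (1 : ℂ) : β ⊕ (γ ⊕ δ) → ℂ))) 0 := by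
  have key : ∀ y : β ⊕ (γ ⊕ δ) → ℂ, deriv (fun t : ℂ => f (w + t • y)) 0 = fderiv ℂ f w y := by
    intro y
    have hl : HasDerivAt (fun t : ℂ => w + t • y) y 0 := by
      simpa using ((hasDerivAt_id (0 : ℂ)).smul_const y).const_add w
    have hf' : HasFDerivAt f (fderiv ℂ f w) (w + (0 : ℂ) • y) := by simpa using (hf w).hasFDerivAt
    exact (hf'.comp_hasDerivAt (0 : ℂ) hl).deriv
  simp only [key]
  have hx : x = ∑ k, x k • (Pi.single k (1 : ℂ) : β ⊕ (γ ⊕ δ) → ℂ) := by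
    ext i
    simp [Finset.sum_apply, Pi.single_apply]
  conv_lhs => rw [hx]
  rw [map_sum]
  exact Finset.sum_congr rfl fun k _ => by rw [map_smul, smul_eq_mul]

/-- The derivative of `Θ_J` along `x`, decomposed. [folklore] -/
theorem deriv_theta_line (J : Option β × ThetaIdx γ δ) (w x : β ⊕ (γ ⊕ δ) → ℂ) :
    deriv (fun t : ℂ => theta L κM J (w + t • x)) 0 =
      ∑ k, x k * deriv (fun t : ℂ => theta L κM J (w + t • (Pi.single k (1 : ℂ) : β ⊕ (γ ⊕ δ) → ℂ))) 0 :=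
  deriv_line_eq_sum (differentiable_theta L κM J) w x

/-! ### The quadratic forms -/

/-- **The Wronskian forms along the coordinate directions.** Along `y_j`:
`([a=j] - [a'=j]) X_I X_J`; along `s_e`: `[o=e] X_J X_{(a,(A,∅))} - [o'=e] X_I X_{(a',(B,∅))}`; along
`z'_b`: the form of the block master identity with the tables `ω, r, t`. [folklore] -/
def wronskForm : (β ⊕ (γ ⊕ δ)) → Option β × ThetaIdx γ δ → Option β × ThetaIdx γ δ →
    MvPolynomial (Option β × ThetaIdx γ δ) ℂ
  | Sum.inl j, (a, I), (a', J) =>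
      C ((if a = some j then 1 else 0) - (if a' = some j then 1 else 0)) * (X (a, I) * X (a', J))
  | Sum.inr (Sum.inr e), (a, (A, o)), (a', (B, o')) =>
      C (if o = some e then 1 else 0) * (X (a', (B, o')) * X (a, (A, none))) -
        C (if o' = some e then 1 else 0) * (X (a, (A, o)) * X (a', (B, none)))
  | Sum.inr (Sum.inl b), (a, (A, o)), (a', (B, o')) =>
      ∑ l : Fin 3, ∑ m : Fin 3,
        (C (L.wTabE (A b) (B b) l m) * (X (a, (Function.update A b l, o)) * X (a', (Function.update B b m, o'))) +
          C (kapO κM o b * L.wTabR (A b) (B b) l m) *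
            (X (a, (Function.update A b l, none)) * X (a', (Function.update B b m, o'))) -
          C (kapO κM o' b * L.wTabR (B b) (A b) l m) *
            (X (a, (Function.update A b m, o)) * X (a', (Function.update B b l, none))) +
          C (kapO κM o b * kapO κM o' b * L.wTabT (A b) (B b) l m) *
            (X (a, (Function.update A b l, none)) * X (a', (Function.update B b m, none))))

/-- **The Wronskian form along `x`**: `Q_{x,I,J} = ∑_k x_k Q_{k,I,J}`. [cite: NesterenkoPhilippon2001, Ch. 11 Lemma 3.1] -/
def wronsk (x : β ⊕ (γ ⊕ δ) → ℂ) (I J : Option β × ThetaIdx γ δ) : MvPolynomial (Option β × ThetaIdx γ δ) ℂ :=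
  ∑ k, C (x k) * wronskForm L κM k I J

omit [Fintype β] [Fintype γ] [Fintype δ] in
/-- The coordinate Wronskian forms are quadratic. [folklore] -/
theorem wronskForm_isHomogeneous (k : β ⊕ (γ ⊕ δ)) (I J : Option β × ThetaIdx γ δ) :
    (wronskForm L κM k I J).IsHomogeneous 2 := by
  have hXX : ∀ (P Q : Option β × ThetaIdx γ δ) (c : ℂ),
      (C c * (X P * X Q) : MvPolynomial (Option β × ThetaIdx γ δ) ℂ).IsHomogeneous 2 := by
    intro P Q c
    simpa using ((isHomogeneous_X ℂ P).mul (isHomogeneous_X ℂ Q)).C_mul c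
  obtain ⟨a, A, o⟩ := I
  obtain ⟨a', B, o'⟩ := J
  rcases k with j | b | e
  · exact hXX _ _ _
  · exact IsHomogeneous.sum _ _ _ fun l _ => IsHomogeneous.sum _ _ _ fun m _ =>
      (((hXX _ _ _).add (hXX _ _ _)).sub (hXX _ _ _)).add (hXX _ _ _)
  · exact (hXX _ _ _).sub (hXX _ _ _)

/-- **The Wronskian forms are quadratic** (field `isHomogeneous_wronsk`). [folklore] -/
theorem wronsk_isHomogeneous (x : β ⊕ (γ ⊕ δ) → ℂ) (I J : Option β × ThetaIdx γ δ) :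
    (wronsk L κM x I J).IsHomogeneous 2 := by
  unfold wronsk
  refine IsHomogeneous.sum _ _ _ fun k _ => ?_
  simpa using (wronskForm_isHomogeneous L κM k I J).C_mul (x k)

/-! ### The Wronskians along the coordinate directions -/

omit [Fintype β] [Fintype δ] in
/-- Along `y_j`. [folklore] -/
theorem wronskian_iy (I J : Option β × ThetaIdx γ δ) (w : β ⊕ (γ ⊕ δ) → ℂ) (j : β) :
    theta L κM J w * deriv (fun t : ℂ => theta L κM I (w + t • (Pi.single (iy j) (1 : ℂ) : β ⊕ (γ ⊕ δ) → ℂ))) 0 -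
        theta L κM I w * deriv (fun t : ℂ => theta L κM J (w + t • (Pi.single (iy j) (1 : ℂ) : β ⊕ (γ ⊕ δ) → ℂ))) 0 =
      thetaEval L κM (wronskForm L κM (iy j) I J) w := by
  obtain ⟨a, I'⟩ := I
  obtain ⟨a', J'⟩ := J
  rw [(hasDerivAt_theta_iy L κM a I' w j).deriv, (hasDerivAt_theta_iy L κM a' J' w j).deriv]
  simp only [iy, wronskForm, thetaEval, map_mul, map_sub, eval_C, eval_X]
  ring

omit [Fintype β] [Fintype δ] in
/-- Along `s_e`. [folklore] -/
theorem wronskian_is (I J : Option β × ThetaIdx γ δ) (w : β ⊕ (γ ⊕ δ) → ℂ) (e : δ) :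
    theta L κM J w * deriv (fun t : ℂ => theta L κM I (w + t • (Pi.single (is e) (1 : ℂ) : β ⊕ (γ ⊕ δ) → ℂ))) 0 -
        theta L κM I w * deriv (fun t : ℂ => theta L κM J (w + t • (Pi.single (is e) (1 : ℂ) : β ⊕ (γ ⊕ δ) → ℂ))) 0 =
      thetaEval L κM (wronskForm L κM (is e) I J) w := by
  obtain ⟨a, A, o⟩ := I
  obtain ⟨a', B, o'⟩ := J
  rw [(hasDerivAt_theta_is L κM a A o w e).deriv, (hasDerivAt_theta_is L κM a' B o' w e).deriv]
  simp only [is, wronskForm, thetaEval, map_mul, map_sub, eval_C, eval_X]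
  ring

omit [Fintype β] [Fintype δ] in
/-- The value of the `z'_b`-form: the right-hand side of the block master identity times `T_a T_{a'}`.
[folklore] -/
theorem thetaEval_wronskForm_iz (a a' : Option β) (A B : γ → Fin 3) (o o' : Option δ) (b : γ) (w : β ⊕ (γ ⊕ δ) → ℂ) :
    thetaEval L κM (wronskForm L κM (iz b) (a, (A, o)) (a', (B, o'))) w =
      thetaT (γ := γ) (δ := δ) a w * thetaT (γ := γ) (δ := δ) a' w *
        ∑ l : Fin 3, ∑ m : Fin 3,
          (L.wTabE (A b) (B b) l m *
              ((L.univExtP l (w (iz b)) * lamFac L κM A o b w - kapO κM o b * L.univExtZ l (w (iz b)) * aFac L A b w) *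
                (L.univExtP m (w (iz b)) * lamFac L κM B o' b w - kapO κM o' b * L.univExtZ m (w (iz b)) * aFac L B b w)) +
            kapO κM o b * L.wTabR (A b) (B b) l m *
              ((L.univExtP l (w (iz b)) * aFac L A b w) *
                (L.univExtP m (w (iz b)) * lamFac L κM B o' b w - kapO κM o' b * L.univExtZ m (w (iz b)) * aFac L B b w)) -
            kapO κM o' b * L.wTabR (B b) (A b) l m *
              ((L.univExtP m (w (iz b)) * lamFac L κM A o b w - kapO κM o b * L.univExtZ m (w (iz b)) * aFac L A b w) *
                (L.univExtP l (w (iz b)) * aFac L B b w)) +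
            kapO κM o b * kapO κM o' b * L.wTabT (A b) (B b) l m *
              ((L.univExtP l (w (iz b)) * aFac L A b w) * (L.univExtP m (w (iz b)) * aFac L B b w))) := by
  have hθ : ∀ (a₁ : Option β) (N : γ → Fin 3) (o₁ : Option δ) (l : Fin 3),
      theta L κM (a₁, (Function.update N b l, o₁)) w =
        thetaT (γ := γ) (δ := δ) a₁ w * (L.univExtP l (w (iz b)) * lamFac L κM N o₁ b w -
          kapO κM o₁ b * L.univExtZ l (w (iz b)) * aFac L N b w) := by
    intro a₁ N o₁ l
    rw [theta, thetaP_update_eq]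
  have hθ0 : ∀ (a₁ : Option β) (N : γ → Fin 3) (l : Fin 3),
      theta L κM (a₁, (Function.update N b l, none)) w =
        thetaT (γ := γ) (δ := δ) a₁ w * (L.univExtP l (w (iz b)) * aFac L N b w) := by
    intro a₁ N l
    rw [hθ, kapO_none, lamFac_none]
    ring
  simp only [iz, wronskForm, thetaEval, map_sum, map_add, map_sub, map_mul, eval_C, eval_X]
  simp only [show (Sum.inr (Sum.inl b) : β ⊕ (γ ⊕ δ)) = iz b from rfl] at *
  rw [Finset.mul_sum]
  refine Finset.sum_congr rfl fun l _ => ?_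
  rw [Finset.mul_sum]
  refine Finset.sum_congr rfl fun m _ => ?_
  rw [hθ a A o l, hθ a' B o' m, hθ0 a A l, hθ0 a' B l, hθ a A o m, hθ0 a' B m]
  ring

omit [Fintype β] [Fintype δ] in
/-- **Along `z'_b`** (off the divisor `z'_b ∈ Λ`): the block master identity. [folklore] -/
theorem wronskian_iz (I J : Option β × ThetaIdx γ δ) {w : β ⊕ (γ ⊕ δ) → ℂ} (b : γ) (hw : w (iz b) ∉ L.lattice) :
    theta L κM J w * deriv (fun t : ℂ => theta L κM I (w + t • (Pi.single (iz b) (1 : ℂ) : β ⊕ (γ ⊕ δ) → ℂ))) 0 -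
        theta L κM I w * deriv (fun t : ℂ => theta L κM J (w + t • (Pi.single (iz b) (1 : ℂ) : β ⊕ (γ ⊕ δ) → ℂ))) 0 =
      thetaEval L κM (wronskForm L κM (iz b) I J) w := by
  obtain ⟨a, A, o⟩ := I
  obtain ⟨a', B, o'⟩ := J
  rw [(hasDerivAt_theta_iz L κM a A o b w).deriv, (hasDerivAt_theta_iz L κM a' B o' b w).deriv,
    thetaEval_wronskForm_iz, ← L.blockMaster (A b) (B b) hw]
  have hI : theta L κM (a, (A, o)) w = thetaT (γ := γ) (δ := δ) a w *
      (L.univExtP (A b) (w (iz b)) * lamFac L κM A o b w - kapO κM o b * L.univExtZ (A b) (w (iz b)) * aFac L A b w) := by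
    rw [theta, thetaP_eq_decomp L κM A o b]
  have hJ : theta L κM (a', (B, o')) w = thetaT (γ := γ) (δ := δ) a' w *
      (L.univExtP (B b) (w (iz b)) * lamFac L κM B o' b w - kapO κM o' b * L.univExtZ (B b) (w (iz b)) * aFac L B b w) := by
    rw [theta, thetaP_eq_decomp L κM B o' b]
  rw [hI, hJ]
  ring

/-! ### The main theorem -/

/-- **The Wronskians on the dense set `offDiv`.** [folklore] -/
theorem F_wronsk_of_mem_offDiv (x : β ⊕ (γ ⊕ δ) → ℂ) (I J : Option β × ThetaIdx γ δ) {w : β ⊕ (γ ⊕ δ) → ℂ}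
    (hw : w ∈ offDiv L β γ δ) :
    theta L κM J w * deriv (fun t : ℂ => theta L κM I (w + t • x)) 0 -
        theta L κM I w * deriv (fun t : ℂ => theta L κM J (w + t • x)) 0 =
      thetaEval L κM (wronsk L κM x I J) w := by
  rw [deriv_theta_line L κM I w x, deriv_theta_line L κM J w x, Finset.mul_sum, Finset.mul_sum, ← Finset.sum_sub_distrib]
  unfold wronsk
  rw [thetaEval, map_sum]
  refine Finset.sum_congr rfl fun k _ => ?_
  rw [map_mul, eval_C, ← thetaEval]
  have hk : theta L κM J w * deriv (fun t : ℂ => theta L κM I (w + t • (Pi.single k (1 : ℂ) : β ⊕ (γ ⊕ δ) → ℂ))) 0 -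
      theta L κM I w * deriv (fun t : ℂ => theta L κM J (w + t • (Pi.single k (1 : ℂ) : β ⊕ (γ ⊕ δ) → ℂ))) 0 =
      thetaEval L κM (wronskForm L κM k I J) w := by
    rcases k with j | b | e
    · exact wronskian_iy L κM I J w j
    · exact wronskian_iz L κM I J b (hw b)
    · exact wronskian_is L κM I J w e
  rw [← hk]
  ring

omit [DecidableEq γ] [DecidableEq β] [DecidableEq δ] in
/-- The derivative along `x` is a continuous function of the base point. [folklore] -/
theorem continuous_deriv_line {f : (β ⊕ (γ ⊕ δ) → ℂ) → ℂ} (hf : ContDiff ℂ ω f) (x : β ⊕ (γ ⊕ δ) → ℂ) :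
    Continuous fun w => deriv (fun t : ℂ => f (w + t • x)) 0 := by
  have key : ∀ w, deriv (fun t : ℂ => f (w + t • x)) 0 = fderiv ℂ f w x := by
    intro w
    have hl : HasDerivAt (fun t : ℂ => w + t • x) x 0 := by
      simpa using ((hasDerivAt_id (0 : ℂ)).smul_const x).const_add w
    have hf' : HasFDerivAt f (fderiv ℂ f w) (w + (0 : ℂ) • x) := by
      simpa using (hf.differentiable (by simp) w).hasFDerivAt
    exact (hf'.comp_hasDerivAt (0 : ℂ) hl).deriv
  simp only [key]
  exact (hf.continuous_fderiv (by simp)).clm_apply continuous_const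

/-- **The Wronskians of the theta model are quadratic forms (field `F_wronsk` of `AnalyticGroupModel`)**:
for every direction `x` and all `I, J`,
`Θ_J(w) ∂_xΘ_I(w) - Θ_I(w) ∂_xΘ_J(w) = Q_{x,I,J}(Θ(w))` at every `w ∈ Lie M_κ,ℂ`.
[cite: NesterenkoPhilippon2001, Ch. 11 Lemma 3.1] -/
theorem F_wronsk (x : β ⊕ (γ ⊕ δ) → ℂ) (I J : Option β × ThetaIdx γ δ) (w : β ⊕ (γ ⊕ δ) → ℂ) :
    theta L κM J w * deriv (fun t : ℂ => theta L κM I (w + t • x)) 0 -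
        theta L κM I w * deriv (fun t : ℂ => theta L κM J (w + t • x)) 0 =
      thetaEval L κM (wronsk L κM x I J) w := by
  -- both sides are continuous in `w` and agree on the dense set `offDiv`
  have hθc : ∀ K : Option β × ThetaIdx γ δ, ContDiff ℂ ω (theta L κM K) := fun K => by
    have h := contDiff_thetaEval L κM (X K)
    have hfun : thetaEval L κM (X K) = theta L κM K := funext fun w => by simp [thetaEval]
    rwa [hfun] at h
  have hL : Continuous fun w => theta L κM J w * deriv (fun t : ℂ => theta L κM I (w + t • x)) 0 -
      theta L κM I w * deriv (fun t : ℂ => theta L κM J (w + t • x)) 0 :=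
    ((differentiable_theta L κM J).continuous.mul (continuous_deriv_line (hθc I) x)).sub
      ((differentiable_theta L κM I).continuous.mul (continuous_deriv_line (hθc J) x))
  have hR : Continuous fun w => thetaEval L κM (wronsk L κM x I J) w := (contDiff_thetaEval L κM _).continuous
  have hclosed : IsClosed {w : β ⊕ (γ ⊕ δ) → ℂ | theta L κM J w * deriv (fun t : ℂ => theta L κM I (w + t • x)) 0 -
      theta L κM I w * deriv (fun t : ℂ => theta L κM J (w + t • x)) 0 = thetaEval L κM (wronsk L κM x I J) w} :=
    isClosed_eq hL hR
  have hdense : Dense {w : β ⊕ (γ ⊕ δ) → ℂ | theta L κM J w * deriv (fun t : ℂ => theta L κM I (w + t • x)) 0 -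
      theta L κM I w * deriv (fun t : ℂ => theta L κM J (w + t • x)) 0 = thetaEval L κM (wronsk L κM x I J) w} :=
    (dense_offDiv L).mono fun w hw => F_wronsk_of_mem_offDiv L κM x I J hw
  have huniv := hdense.closure_eq
  rw [hclosed.closure_eq] at huniv
  have hmem : w ∈ (Set.univ : Set (β ⊕ (γ ⊕ δ) → ℂ)) := Set.mem_univ w
  rw [← huniv] at hmem
  exact hmem

end Std

end GaGmE

end Literature.NumberTheory.Transcendental

end
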